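import Literature.NumberTheory.LFunctions.SchoenfeldExplicitNumerics
import Literature.NumberTheory.LFunctions.LogIntegralStrictMonoProofs
import Literature.Analysis.ValidatedNumerics.FixedPointInterval
import HarnessLib

/-!
# Schoenfeld 1976, Cor. 1 on `[2659, 10⁸)`: a certified computation of `|π(x) − li(x)| < √x log x/(8π)`

Topic: `Literature/NumberTheory/LFunctions`. The finite range of the discharge of
`Literature.NumberTheory.LFunctions.schoenfeld_explicit` (L. Schoenfeld, Math. Comp. 30 (1976), Cor. 1 (6.18): under RH
`|π(x) − li(x)| < √x log x/(8π)` for `x ≥ 2657`). Schoenfeld covers `[2657, 23·10⁸]` by the tables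
of Brent (Math. Comp. 29 (1975), Table 1) and Appel–Rosser (1961); here the (unconditional!)
inequality on `[2659, 10⁸)` is re-done *inside Lean* by an executable checker with a complete
soundness proof, each block of the range being one `native_decide` (files `SchoenfeldSieve/Chunk*.lean`,
declared `computational`), exactly as for the tree's `LiouvilleSieve.lean`:

* **cells.** The range is cut into cells of integers `[a, b)`; for real `x ∈ [a, b)` one has
  `π(x) = π(⌊x⌋) ∈ [π(a), π(b−1)]`, `li(a) ≤ li(x) ≤ li(b)` (`li` increasing on `(1,∞)`,
  `strictMonoOn_logIntegral_holds`) and `√a log a ≤ √x log x`, so the two integer checks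
  `(liHi b − π(a)·2⁸⁰)·K < isqrt(a)·Llo(a)·10⁶` and `(π(b−1)·2⁸⁰ − liLo a)·K < isqrt(a)·Llo(a)·10⁶`
  (`K = 25132744 ≥ 8π·10⁶`, `Llo(a)/2⁸⁰ ≤ log a` from `KernelLog.logIv`) give (6.18) on the cell
  (`cell_sound`); the cells are chosen adaptively by the checker (`runCells`), about `3000` in all;
* **primes.** `π` is accumulated by trial division over the tree's kernel-verified table of the primes
  `≤ 10007` (`SchoenfeldNumerics.primeTable`, complete by `PrimeTable.tableOK_complete`), valid below
  `10007² > 10⁸` (`isPrimeF_iff`);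
* **`li`.** `liLo x ≤ 2⁸⁰ li x ≤ liHi x` from Ramanujan's series
  `li x = γ + log log x + ∑_{k≥1} (log x)^k/(k·k!)` (`SchoenfeldNumerics.logIntegral_mem_Icc`, 75 terms,
  tail `≤ x (log x)⁷⁶/(76·76!)`), with `log x` and `log log x` from `KernelLog.logIv` and the partial
  sums in fixed point `2⁻⁸⁰` with directed rounding (`seriesHi_sound`, `seriesLo_sound`; `cdiv` and its two lemmas are the tree's
  `Literature.Analysis.ValidatedNumerics.Numerics.cdiv` / `div_le_cdiv` / `fdiv_le_div`).

Main statements: `runCells_sound` (a passing run from `a` to `stop` with the correct count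
`π(a−1)` returns `π(stop−1)` and proves (6.18) on `[a, stop)`), and the per-block interface
`SegOK` / `segOK_step` consumed by `SchoenfeldSieve/Chunk*.lean` and the final assembly. Nothing here
uses the Riemann hypothesis.

## References

* L. Schoenfeld, Math. Comp. 30 (1976), 337–360, proof of Cor. 1 (p. 340: Brent's and the
  Appel–Rosser tables). [Schoenfeld1976]
* R. P. Brent, Math. Comp. 29 (1975), 43–56, Table 1. [Brent1975]
-/

open Literature.Analysis.SpecialFunctions.KernelLog Finset
open scoped Chebyshev

namespace Literature.NumberTheory.LFunctions

namespace SchoenfeldSieve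

open SchoenfeldNumerics PrimeTable
open Literature.Analysis.ValidatedNumerics.Numerics (cdiv fdiv_le_div div_le_cdiv)

/-! ## The executable checker -/

/-- Scale `2⁸⁰`. [folklore] -/
def SC : ℤ := 2 ^ 80

/-- Number of series terms. [folklore] -/
def NT : ℕ := 75

/-- `⌈0.57721571·2⁸⁰⌉ ≥ 2⁸⁰γ`. [folklore] -/
def GHI : ℤ := 697810975306190105464740

/-- `⌊0.57721558·2⁸⁰⌋ ≤ 2⁸⁰γ`. [folklore] -/
def GLO : ℤ := 697810818145833555562946

/-- `K = 25132744 ≥ 8π·10⁶`. [folklore] -/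
def KK : ℤ := 25132744

/-- Upper fixed-point values of `a_k = U^k/k!` (`U = u/2⁸⁰`): `goHi u fuel k A acc` runs `k, …` and returns
`(∑ ⌈A_k/k⌉, last A)`. [folklore] -/
def goHi (u : ℤ) : ℕ → ℕ → ℤ → ℤ → ℤ × ℤ
  | 0, _, A, acc => (acc, A)
  | fuel + 1, k, A, acc =>
      let A' := cdiv (A * u) ((k : ℤ) * SC)
      goHi u fuel (k + 1) A' (acc + cdiv A' k)

/-- `seriesHi u = (T, A)` with `T/2⁸⁰ ≥ ∑_{k<NT} U^{k+1}/((k+1)(k+1)!)` and `A/2⁸⁰ ≥ U^{NT+1}/(NT+1)!`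
(the last accumulated term is dropped from `T` by running `NT` steps for `T` and one more for `A`). [folklore] -/
def seriesHi (u : ℤ) : ℤ × ℤ :=
  let r := goHi u NT 1 SC 0
  (r.1, cdiv (r.2 * u) (((NT : ℤ) + 1) * SC))

/-- Lower fixed-point partial sums at `L = l/2⁸⁰`. [folklore] -/
def goLo (l : ℤ) : ℕ → ℕ → ℤ → ℤ → ℤ
  | 0, _, _, acc => acc
  | fuel + 1, k, A, acc =>
      let A' := (A * l) / ((k : ℤ) * SC)
      goLo l fuel (k + 1) A' (acc + A' / k)

/-- `seriesLo l / 2⁸⁰ ≤ ∑_{k<NT} L^{k+1}/((k+1)(k+1)!)`. [folklore] -/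
def seriesLo (l : ℤ) : ℤ := goLo l NT 1 SC 0

/-- Upper bound for `2⁸⁰ log(Lhi/2⁸⁰)` (`Lhi ≥ 0`): `log(m/2²⁰)`, `m = Lhi/2⁶⁰ + 1`. [folklore] -/
def loglogHi (Lhi : ℤ) : Option ℤ :=
  match logIv (Lhi.toNat / 2 ^ 60 + 1) with
  | some (_, hi) => some (hi - 20 * L2LO)
  | none => none

/-- Lower bound for `2⁸⁰ log(Llo/2⁸⁰)` (`Llo ≥ 2⁶⁰`): `log(m/2²⁰)`, `m = Llo/2⁶⁰`. [folklore] -/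
def loglogLo (Llo : ℤ) : Option ℤ :=
  match logIv (Llo.toNat / 2 ^ 60) with
  | some (lw, _) => some (lw - 20 * L2HI)
  | none => none

/-- `liHi x ≥ 2⁸⁰ li x` (for `x > 1`, when defined). [folklore] -/
def liHi (x : ℕ) : Option ℤ :=
  match logIv x with
  | some (_, Lhi) =>
      match loglogHi Lhi with
      | some ll =>
          let s := seriesHi Lhi
          some (GHI + ll + s.1 + (x : ℤ) * cdiv s.2 ((NT : ℤ) + 1))
      | none => none
  | none => none

/-- `liLo x ≤ 2⁸⁰ li x` (for `x > 1`, when defined). [folklore] -/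
def liLo (x : ℕ) : Option ℤ :=
  match logIv x with
  | some (Llo, _) =>
      match loglogLo Llo with
      | some ll => some (GLO + ll + seriesLo Llo)
      | none => none
  | none => none

/-- Primality below `10007²` by trial division over the table of primes `≤ 10007`. [folklore] -/
def isPrimeF (n : ℕ) : Bool := decide (2 ≤ n) && (firstFactor primeTable n).isNone

/-- Count the primes in `n, n+1, …, n+len-1` on top of `cnt`. [folklore] -/
def countFrom (n : ℕ) : ℕ → ℕ → ℕ
  | 0, cnt => cnt
  | len + 1, cnt => countFrom (n + 1) len (if isPrimeF n then cnt + 1 else cnt)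

/-- The data of one cell check at `a`: `(Llo a, rhs = isqrt a · Llo a · 10⁶)`, or `none`. [folklore] -/
def cellData (a : ℕ) : Option (ℤ × ℤ) :=
  match logIv a with
  | some (Llo, _) => if 0 < Llo then some (Llo, (Nat.sqrt a : ℤ) * Llo * 1000000) else none
  | none => none

/-- **The cell loop.** `runCells fuel a stop cntPrev lhA`: starting a cell at `a` with `cntPrev = π(a−1)`
(and `lhA = liHi a`, used only to choose the cell length), check the cells up to `stop` and return
`π(stop − 1)`; `none` on any failure. [folklore] -/
def runCells : ℕ → ℕ → ℕ → ℕ → ℤ → Option ℕ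
  | 0, a, stop, cnt, _ => if a = stop then some cnt else none
  | fuel + 1, a, stop, cntPrev, lhA =>
      if stop ≤ a then (if a = stop then some cntPrev else none) else
      let pia := if isPrimeF a then cntPrev + 1 else cntPrev
      match cellData a, liLo a with
      | some (Llo, rhs), some llA =>
          let slack := rhs / KK - (lhA - (pia : ℤ) * SC)
          let step := (slack * Llo * 4 / 5 / (SC * SC)).toNat
          let b := min stop (a + max 1 step)
          let pib := countFrom (a + 1) (b - (a + 1)) pia          -- π(b − 1)
          match liHi b with
          | some lhB =>
              if ((pib : ℤ) * SC - llA) * KK < rhs ∧ (lhB - (pia : ℤ) * SC) * KK < rhs then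
                runCells fuel b stop pib lhB
              else none
          | none => none
      | _, _ => none

/-- The block check: `checkSeg a stop cntIn cntOut = true` iff the cell loop from `a` (with `π(a−1) = cntIn`
claimed) to `stop` passes and returns `cntOut`. [folklore] -/
def checkSeg (a stop cntIn cntOut : ℕ) : Bool :=
  match liHi a with
  | some lhA => (runCells (stop - a + 1) a stop cntIn lhA) == some cntOut
  | none => false


/-! ## Soundness of the arithmetic -/

section Soundness

/-- `SC = 2⁸⁰ > 0`, in `ℝ`. [folklore] -/
theorem SC_pos : (0 : ℝ) < (SC : ℝ) := by unfold SC; positivity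

/-- `(SC : ℝ) = 2⁸⁰`. [folklore] -/
theorem SC_eq : ((SC : ℤ) : ℝ) = (2 : ℝ) ^ 80 := by unfold SC; push_cast; ring

/-- The exact values `a_k = U^k/k!` and the partial sums `t_k = ∑_{j<k} U^{j+1}/((j+1)(j+1)!)`. [folklore] -/
theorem goHi_sound (U : ℝ) (u : ℤ) (hU : 0 ≤ U) (hu : U * SC ≤ u) :
    ∀ (fuel k : ℕ) (A acc : ℤ) (hk : 1 ≤ k),
      U ^ (k - 1) / ((k - 1).factorial : ℝ) * SC ≤ A →
      (∑ j ∈ range (k - 1), U ^ (j + 1) / ((j + 1 : ℝ) * ((j + 1).factorial : ℝ))) * SC ≤ acc →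
      (∑ j ∈ range (k - 1 + fuel), U ^ (j + 1) / ((j + 1 : ℝ) * ((j + 1).factorial : ℝ))) * SC ≤ (goHi u fuel k A acc).1 ∧
        U ^ (k - 1 + fuel) / ((k - 1 + fuel).factorial : ℝ) * SC ≤ (goHi u fuel k A acc).2 := by
  intro fuel
  induction fuel with
  | zero =>
    intro k A acc hk hA hacc
    simp only [goHi, add_zero]
    exact ⟨hacc, hA⟩
  | succ fuel ih =>
    intro k A acc hk hA hacc
    simp only [goHi]
    have hSC := SC_pos
    have hk0 : (0 : ℝ) < k := by exact_mod_cast hk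
    -- the new `A' ≥ U^k/k! · SC`
    set A' : ℤ := cdiv (A * u) ((k : ℤ) * SC) with hA'
    have hA'ge : U ^ k / (k.factorial : ℝ) * SC ≤ A' := by
      have hSCpos : (0 : ℤ) < SC := by unfold SC; norm_num
      have h1 := div_le_cdiv (a := A * u) (b := (k : ℤ) * SC)
        (mul_pos (by exact_mod_cast hk) hSCpos)
      rw [hA']
      refine le_trans ?_ h1
      push_cast
      rw [le_div_iff₀ (by positivity)]
      have hfac : (k.factorial : ℝ) = k * ((k - 1).factorial : ℝ) := by
        rcases k with _ | k
        · omega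
        · simp [Nat.factorial_succ]
      have hpow : U ^ k = U ^ (k - 1) * U := by
        rcases k with _ | k
        · omega
        · simp [pow_succ]
      rw [hfac, hpow]
      have hA0 : 0 ≤ U ^ (k - 1) / ((k - 1).factorial : ℝ) * SC := by positivity
      have hAnn : (0 : ℝ) ≤ A := le_trans hA0 hA
      calc U ^ (k - 1) * U / (↑k * ((k - 1).factorial : ℝ)) * SC * (↑k * SC)
          = (U ^ (k - 1) / ((k - 1).factorial : ℝ) * SC) * (U * SC) := by field_simp
        _ ≤ (A : ℝ) * u := mul_le_mul hA hu (by positivity) hAnn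
    have hacc' : (∑ j ∈ range k, U ^ (j + 1) / ((j + 1 : ℝ) * ((j + 1).factorial : ℝ))) * SC ≤
        (acc + cdiv A' k : ℤ) := by
      have hsplit : ∑ j ∈ range k, U ^ (j + 1) / ((j + 1 : ℝ) * ((j + 1).factorial : ℝ)) =
          ∑ j ∈ range (k - 1), U ^ (j + 1) / ((j + 1 : ℝ) * ((j + 1).factorial : ℝ)) +
            U ^ k / ((k : ℝ) * (k.factorial : ℝ)) := by
        rcases k with _ | k
        · omega
        · rw [Nat.add_sub_cancel, sum_range_succ]; push_cast; ring_nf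
      rw [hsplit, add_mul]
      have h2 := div_le_cdiv (a := A') (b := (k : ℤ)) (by exact_mod_cast hk)
      push_cast at h2 ⊢
      have h3 : U ^ k / ((k : ℝ) * (k.factorial : ℝ)) * SC ≤ (A' : ℝ) / k := by
        rw [le_div_iff₀ hk0]
        calc U ^ k / (↑k * (k.factorial : ℝ)) * SC * k = U ^ k / (k.factorial : ℝ) * SC := by field_simp
          _ ≤ A' := hA'ge
      linarith
    have := ih (k + 1) A' (acc + cdiv A' k) (by omega) (by simpa using hA'ge) (by simpa using hacc')
    rw [show k - 1 + (fuel + 1) = k + fuel by omega]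
    simpa using this

/-- **`seriesHi` is an upper bound**: for `0 ≤ U ≤ u/2⁸⁰`,
`(∑_{k<NT} U^{k+1}/((k+1)(k+1)!))·2⁸⁰ ≤ (seriesHi u).1` and `(U^{NT+1}/(NT+1)!)·2⁸⁰ ≤ (seriesHi u).2`. [folklore] -/
theorem seriesHi_sound (U : ℝ) (u : ℤ) (hU : 0 ≤ U) (hu : U * SC ≤ u) :
    (∑ j ∈ range NT, U ^ (j + 1) / ((j + 1 : ℝ) * ((j + 1).factorial : ℝ))) * SC ≤ (seriesHi u).1 ∧
      U ^ (NT + 1) / ((NT + 1).factorial : ℝ) * SC ≤ (seriesHi u).2 := by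
  have h := goHi_sound U u hU hu NT 1 SC 0 le_rfl (by simp) (by simp)
  simp only [Nat.sub_self, zero_add] at h
  refine ⟨h.1, ?_⟩
  unfold seriesHi
  dsimp only
  generalize hg : goHi u NT 1 SC 0 = g at h ⊢
  have hSC := SC_pos
  have hNT : (0 : ℤ) < (NT : ℤ) + 1 := by norm_num [NT]
  have h1 := div_le_cdiv (a := g.2 * u) (b := ((NT : ℤ) + 1) * SC)
    (mul_pos hNT (by unfold SC; norm_num))
  refine le_trans ?_ h1
  have hNT' : (0 : ℝ) < (NT : ℝ) + 1 := by positivity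
  generalize NT = N at h hNT' ⊢
  push_cast
  rw [le_div_iff₀ (by positivity), Nat.factorial_succ, pow_succ]
  push_cast
  have hAnn : (0 : ℝ) ≤ g.2 := le_trans (by positivity) h.2
  calc U ^ N * U / ((↑N + 1) * (N.factorial : ℝ)) * SC * ((↑N + 1) * SC)
      = (U ^ N / (N.factorial : ℝ) * SC) * (U * SC) := by field_simp
    _ ≤ (g.2 : ℝ) * u := mul_le_mul h.2 hu (by positivity) hAnn

/-- The lower partial sums: invariant of `goLo`. [folklore] -/
theorem goLo_sound (L : ℝ) (l : ℤ) (hL : 0 ≤ L) (hl0 : 0 ≤ l) (hl : (l : ℝ) ≤ L * SC) :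
    ∀ (fuel k : ℕ) (A acc : ℤ) (hk : 1 ≤ k), 0 ≤ A →
      (A : ℝ) ≤ L ^ (k - 1) / ((k - 1).factorial : ℝ) * SC →
      (acc : ℝ) ≤ (∑ j ∈ range (k - 1), L ^ (j + 1) / ((j + 1 : ℝ) * ((j + 1).factorial : ℝ))) * SC →
      ((goLo l fuel k A acc : ℤ) : ℝ) ≤
        (∑ j ∈ range (k - 1 + fuel), L ^ (j + 1) / ((j + 1 : ℝ) * ((j + 1).factorial : ℝ))) * SC := by
  intro fuel
  induction fuel with
  | zero =>
    intro k A acc hk hA0 hA hacc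
    simp only [goLo, add_zero]
    exact hacc
  | succ fuel ih =>
    intro k A acc hk hA0 hA hacc
    simp only [goLo]
    have hSC := SC_pos
    have hSCpos : (0 : ℤ) < SC := by unfold SC; norm_num
    have hk0 : (0 : ℝ) < k := by exact_mod_cast hk
    set A' : ℤ := (A * l) / ((k : ℤ) * SC) with hA'
    have hfac : (k.factorial : ℝ) = k * ((k - 1).factorial : ℝ) := by
      rcases k with _ | k
      · omega
      · simp [Nat.factorial_succ]
    have hpow : L ^ k = L ^ (k - 1) * L := by
      rcases k with _ | k
      · omega
      · simp [pow_succ]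
    -- `A' ≤ L^k/k! · SC` and `A' ≥ 0` when `l ≥ 0`; if `l < 0` then `L·SC ≥ l` still and `A·l ≤ …`
    have hA'le : (A' : ℝ) ≤ L ^ k / (k.factorial : ℝ) * SC := by
      have h1 := fdiv_le_div (a := A * l) (b := (k : ℤ) * SC) (mul_pos (by exact_mod_cast hk) hSCpos)
      refine h1.trans ?_
      push_cast
      rw [div_le_iff₀ (by positivity), hfac, hpow]
      calc (A : ℝ) * l ≤ (L ^ (k - 1) / ((k - 1).factorial : ℝ) * SC) * (L * SC) := by
            have hAnn : (0 : ℝ) ≤ A := by exact_mod_cast hA0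
            nlinarith [mul_le_mul_of_nonneg_left hl hAnn, mul_le_mul_of_nonneg_right hA (show 0 ≤ L * SC by positivity)]
        _ = L ^ (k - 1) * L / (↑k * ((k - 1).factorial : ℝ)) * SC * (↑k * SC) := by field_simp
    have hA'0 : 0 ≤ A' := Int.ediv_nonneg (mul_nonneg hA0 hl0) (by positivity)
    have hacc' : ((acc + A' / k : ℤ) : ℝ) ≤
        (∑ j ∈ range k, L ^ (j + 1) / ((j + 1 : ℝ) * ((j + 1).factorial : ℝ))) * SC := by
      have hsplit : ∑ j ∈ range k, L ^ (j + 1) / ((j + 1 : ℝ) * ((j + 1).factorial : ℝ)) =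
          ∑ j ∈ range (k - 1), L ^ (j + 1) / ((j + 1 : ℝ) * ((j + 1).factorial : ℝ)) +
            L ^ k / ((k : ℝ) * (k.factorial : ℝ)) := by
        rcases k with _ | k
        · omega
        · rw [Nat.add_sub_cancel, sum_range_succ]; push_cast; ring_nf
      rw [hsplit, add_mul]
      have h2 := fdiv_le_div (a := A') (b := (k : ℤ)) (by exact_mod_cast hk)
      push_cast at h2 ⊢
      have h3 : (A' : ℝ) / k ≤ L ^ k / ((k : ℝ) * (k.factorial : ℝ)) * SC := by
        rw [div_le_iff₀ hk0]
        calc (A' : ℝ) ≤ L ^ k / (k.factorial : ℝ) * SC := hA'le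
          _ = L ^ k / (↑k * (k.factorial : ℝ)) * SC * k := by field_simp
      linarith
    have := ih (k + 1) A' (acc + A' / k) (by omega) hA'0 (by simpa using hA'le) (by simpa using hacc')
    rw [show k - 1 + (fuel + 1) = k + fuel by omega]
    simpa using this

/-- **`seriesLo` is a lower bound**: for `0 ≤ L` with `l ≤ 2⁸⁰L`,
`seriesLo l ≤ (∑_{k<NT} L^{k+1}/((k+1)(k+1)!))·2⁸⁰` (`l ≥ 0`). [folklore] -/
theorem seriesLo_sound (L : ℝ) (l : ℤ) (hL : 0 ≤ L) (hl0 : 0 ≤ l) (hl : (l : ℝ) ≤ L * SC) :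
    ((seriesLo l : ℤ) : ℝ) ≤ (∑ j ∈ range NT, L ^ (j + 1) / ((j + 1 : ℝ) * ((j + 1).factorial : ℝ))) * SC := by
  have h := goLo_sound L l hL hl0 hl NT 1 SC 0 le_rfl (by unfold SC; norm_num) (by simp) (by simp)
  simpa [seriesLo] using h

/-- `L2LO ≤ 2⁸⁰ log 2 ≤ L2HI` (from `LogTwoBounds.lean`). [folklore] -/
theorem L2_bounds : ((L2LO : ℤ) : ℝ) ≤ 2 ^ 80 * Real.log 2 ∧ 2 ^ 80 * Real.log 2 ≤ ((L2HI : ℤ) : ℝ) := by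
  constructor
  · have h1 : ((L2LO : ℤ) : ℚ) ≤ (0.69314718055994530940 : ℚ) * 2 ^ 80 := Int.floor_le _
    have h2 : (((L2LO : ℤ) : ℚ) : ℝ) ≤ (((0.69314718055994530940 : ℚ) * 2 ^ 80 : ℚ) : ℝ) := by
      exact_mod_cast h1
    have h3 := Literature.Analysis.SpecialFunctions.Real.log_two_gt_d20
    push_cast at h2
    nlinarith
  · have h1 : (0.69314718055994530944 : ℚ) * 2 ^ 80 ≤ ((L2HI : ℤ) : ℚ) := Int.le_ceil _
    have h2 : (((0.69314718055994530944 : ℚ) * 2 ^ 80 : ℚ) : ℝ) ≤ (((L2HI : ℤ) : ℚ) : ℝ) := by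
      exact_mod_cast h1
    have h3 := Literature.Analysis.SpecialFunctions.Real.log_two_lt_d20
    push_cast at h2
    nlinarith

/-- **`loglogHi` is an upper bound**: if `loglogHi Lhi = some v`, `0 ≤ Lhi` and `0 < y ≤ Lhi/2⁸⁰`, then
`2⁸⁰ log y ≤ v`. [folklore] -/
theorem loglogHi_sound {Lhi v : ℤ} (h : loglogHi Lhi = some v) (hL : 0 ≤ Lhi) {y : ℝ} (hy : 0 < y)
    (hyL : y * 2 ^ 80 ≤ Lhi) : Real.log y * 2 ^ 80 ≤ v := by
  unfold loglogHi at h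
  split at h
  · rename_i lo hi hlog
    simp only [Option.some.injEq] at h
    subst h
    set m : ℕ := Lhi.toNat / 2 ^ 60 + 1 with hm
    have hms := (logIv_sound hlog).2
    have hm0 : (0 : ℝ) < m := by positivity
    -- `y ≤ m / 2^20`
    have hym : y ≤ (m : ℝ) / 2 ^ 20 := by
      have h1 : (Lhi.toNat : ℤ) = Lhi := Int.toNat_of_nonneg hL
      have h2 : Lhi.toNat < m * 2 ^ 60 := by
        rw [hm, add_mul, one_mul]; exact Nat.lt_div_mul_add (by norm_num)
      have e : ((Lhi.toNat : ℕ) : ℝ) = (Lhi : ℝ) := by exact_mod_cast h1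
      have h2' : ((Lhi.toNat : ℕ) : ℝ) < ((m * 2 ^ 60 : ℕ) : ℝ) := by exact_mod_cast h2
      push_cast at h2'
      rw [e] at h2'
      rw [le_div_iff₀ (by positivity)]
      nlinarith
    have hlog : Real.log y ≤ Real.log m - 20 * Real.log 2 := by
      have := Real.log_le_log hy hym
      rw [Real.log_div hm0.ne' (by positivity), Real.log_pow] at this
      push_cast at this
      linarith
    have hL2 := L2_bounds.1
    push_cast
    nlinarith
  · simp at h

/-- **`loglogLo` is a lower bound**: if `loglogLo Llo = some v`, `2⁶⁰ ≤ Llo` and `Llo/2⁸⁰ ≤ y`, then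
`v ≤ 2⁸⁰ log y`. [folklore] -/
theorem loglogLo_sound {Llo v : ℤ} (h : loglogLo Llo = some v) (hL : 2 ^ 60 ≤ Llo) {y : ℝ}
    (hyL : (Llo : ℝ) ≤ y * 2 ^ 80) : (v : ℝ) ≤ Real.log y * 2 ^ 80 := by
  unfold loglogLo at h
  split at h
  · rename_i lo hi hlog
    simp only [Option.some.injEq] at h
    subst h
    set m : ℕ := Llo.toNat / 2 ^ 60 with hm
    have hms := (logIv_sound hlog).1
    have hL0 : 0 ≤ Llo := le_trans (by norm_num) hL
    have h1 : (Llo.toNat : ℤ) = Llo := Int.toNat_of_nonneg hL0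
    have hm1 : 1 ≤ m := by
      rw [hm, Nat.le_div_iff_mul_le (by norm_num)]
      have : (2 : ℤ) ^ 60 ≤ (Llo.toNat : ℤ) := by rw [h1]; exact hL
      exact_mod_cast this
    have hm0 : (0 : ℝ) < m := by exact_mod_cast hm1
    -- `m / 2^20 ≤ y`
    have hym : (m : ℝ) / 2 ^ 20 ≤ y := by
      have h2 : m * 2 ^ 60 ≤ Llo.toNat := Nat.div_mul_le_self _ _
      have e : ((Llo.toNat : ℕ) : ℝ) = (Llo : ℝ) := by exact_mod_cast h1
      have h2' : ((m * 2 ^ 60 : ℕ) : ℝ) ≤ ((Llo.toNat : ℕ) : ℝ) := by exact_mod_cast h2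
      push_cast at h2'
      rw [e] at h2'
      rw [div_le_iff₀ (by positivity)]
      nlinarith
    have hy : 0 < y := lt_of_lt_of_le (by positivity) hym
    have hlog : Real.log m - 20 * Real.log 2 ≤ Real.log y := by
      have := Real.log_le_log (by positivity) hym
      rw [Real.log_div hm0.ne' (by positivity), Real.log_pow] at this
      push_cast at this
      linarith
    have hL2 := L2_bounds.2
    push_cast
    nlinarith
  · simp at h

/-- `GHI ≥ 2⁸⁰γ` and `GLO ≤ 2⁸⁰γ`. [folklore] -/
theorem gamma_bounds : Real.eulerMascheroniConstant * 2 ^ 80 ≤ ((GHI : ℤ) : ℝ) ∧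
    ((GLO : ℤ) : ℝ) ≤ Real.eulerMascheroniConstant * 2 ^ 80 := by
  have h1 := Literature.Analysis.SpecialFunctions.Real.eulerMascheroniConstant_lt_d8
  have h2 := Literature.Analysis.SpecialFunctions.Real.eulerMascheroniConstant_gt_d8
  unfold GHI GLO
  push_cast
  constructor <;> nlinarith

/-- **`liHi` is an upper bound**: `liHi x = some v`, `1 < x` ⟹ `2⁸⁰ li x ≤ v`. [folklore] -/
theorem liHi_sound {x : ℕ} {v : ℤ} (h : liHi x = some v) (hx : 1 < x) :
    logIntegral x * 2 ^ 80 ≤ v := by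
  unfold liHi at h
  split at h
  · rename_i Llo Lhi hlog
    split at h
    · rename_i ll hll
      simp only [Option.some.injEq] at h
      subst h
      have hx' : (1 : ℝ) < x := by exact_mod_cast hx
      obtain ⟨hLlo, hLhi⟩ := logIv_sound hlog
      have hl0 : 0 < Real.log x := Real.log_pos hx'
      set U : ℝ := (Lhi : ℝ) / 2 ^ 80 with hU
      have hU0 : 0 ≤ U := hl0.le.trans hLhi
      have hLhiR : Real.log x * 2 ^ 80 ≤ Lhi := by
        have := hLhi; rwa [le_div_iff₀ (by positivity)] at this
      have hLhi0 : 0 ≤ Lhi := by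
        have : (0 : ℝ) ≤ Lhi := le_trans (by positivity) hLhiR
        exact_mod_cast this
      have hli := (logIntegral_mem_Icc hx' NT).2
      have hsum := sum_logIntegralSeriesTerm_le hx'.le hLhi NT
      have hser := seriesHi_sound U Lhi hU0 (by rw [hU, SC_eq]; field_simp; rfl)
      rw [SC_eq] at hser
      have hll' := loglogHi_sound hll hLhi0 hl0 hLhiR
      have hγ := gamma_bounds.1
      -- tail: `x (log x)^{NT+1}/((NT+1)(NT+1)!) ≤ x · cdiv A (NT+1) / 2^80`
      have htail : (x : ℝ) * (Real.log x ^ (NT + 1) / ((NT + 1 : ℝ) * ((NT + 1).factorial : ℝ))) * 2 ^ 80 ≤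
          (x : ℝ) * ((cdiv (seriesHi Lhi).2 ((NT : ℤ) + 1) : ℤ) : ℝ) := by
        have h1 := div_le_cdiv (a := (seriesHi Lhi).2) (b := (NT : ℤ) + 1) (by norm_num [NT])
        have h2 : Real.log x ^ (NT + 1) ≤ U ^ (NT + 1) := pow_le_pow_left₀ hl0.le hLhi _
        have hA := hser.2
        generalize (seriesHi Lhi).2 = A at h1 hA
        have hNT : (0 : ℝ) < (NT : ℝ) + 1 := by positivity
        generalize NT = N at h1 h2 hA hNT
        push_cast at h1 ⊢
        have hx0 : (0 : ℝ) ≤ x := by positivity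
        have h3 : Real.log x ^ (N + 1) / ((N + 1 : ℝ) * ((N + 1).factorial : ℝ)) * 2 ^ 80 ≤ (A : ℝ) / (N + 1) := by
          rw [le_div_iff₀ hNT]
          calc Real.log x ^ (N + 1) / ((↑N + 1) * ((N + 1).factorial : ℝ)) * 2 ^ 80 * (↑N + 1)
              = Real.log x ^ (N + 1) / ((N + 1).factorial : ℝ) * 2 ^ 80 := by field_simp
            _ ≤ U ^ (N + 1) / ((N + 1).factorial : ℝ) * 2 ^ 80 := by gcongr
            _ ≤ A := hA
        calc (x : ℝ) * (Real.log x ^ (N + 1) / ((↑N + 1) * ((N + 1).factorial : ℝ))) * 2 ^ 80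
            = (x : ℝ) * (Real.log x ^ (N + 1) / ((↑N + 1) * ((N + 1).factorial : ℝ)) * 2 ^ 80) := by ring
          _ ≤ (x : ℝ) * ((A : ℝ) / (N + 1)) := mul_le_mul_of_nonneg_left h3 hx0
          _ ≤ (x : ℝ) * _ := mul_le_mul_of_nonneg_left h1 hx0
      have hsum' : (∑ k ∈ range NT, logIntegralSeriesTerm (x : ℝ) k) * 2 ^ 80 ≤ ((seriesHi Lhi).1 : ℝ) :=
        le_trans (mul_le_mul_of_nonneg_right hsum (by positivity)) hser.1
      generalize (seriesHi Lhi).1 = T at hsum' ⊢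
      generalize cdiv (seriesHi Lhi).2 ((NT : ℤ) + 1) = A' at htail ⊢
      generalize ∑ k ∈ range NT, logIntegralSeriesTerm (x : ℝ) k = Ssum at hli hsum'
      generalize (x : ℝ) * (Real.log x ^ (NT + 1) / ((NT + 1 : ℝ) * ((NT + 1).factorial : ℝ))) = tl at hli htail
      push_cast
      nlinarith
    · simp at h
  · simp at h

/-- **`liLo` is a lower bound**: `liLo x = some v`, `3 ≤ x` ⟹ `v ≤ 2⁸⁰ li x`. [folklore] -/
theorem liLo_sound {x : ℕ} {v : ℤ} (h : liLo x = some v) (hx : 3 ≤ x) :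
    (v : ℝ) ≤ logIntegral x * 2 ^ 80 := by
  unfold liLo at h
  split at h
  · rename_i Llo Lhi hlog
    split at h
    · rename_i ll hll
      simp only [Option.some.injEq] at h
      subst h
      have hx' : (1 : ℝ) < x := by exact_mod_cast (lt_of_lt_of_le (by norm_num) hx)
      obtain ⟨hLlo, hLhi⟩ := logIv_sound hlog
      have hl0 : 0 < Real.log x := Real.log_pos hx'
      -- `log x ≥ log 3 > 1 ≥ 2^60/2^80`, so `Llo` may be below `2^60` only if the enclosure is loose; we need `2^60 ≤ Llo`
      -- for `loglogLo`; it holds since `Llo/2^80 ≥ log x − 10⁻¹² ≥ 1`.  We derive it from `loglogLo` being `some`: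
      set L : ℝ := (Llo : ℝ) / 2 ^ 80 with hL
      by_cases hLlo60 : 2 ^ 60 ≤ Llo
      · have hLlo0 : (0 : ℝ) ≤ Llo := by exact_mod_cast (le_trans (by norm_num) hLlo60)
        have hL0 : 0 ≤ L := by rw [hL]; positivity
        have hLloR : (Llo : ℝ) ≤ Real.log x * 2 ^ 80 := by
          have := hLlo; rwa [hL, div_le_iff₀ (by positivity)] at this
        have hli := (logIntegral_mem_Icc hx' NT).1
        have hsum := le_sum_logIntegralSeriesTerm hL0 hLlo NT
        have hser := seriesLo_sound L Llo hL0 (le_trans (by norm_num) hLlo60) (by rw [hL, SC_eq]; field_simp; rfl)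
        rw [SC_eq] at hser
        have hll' := loglogLo_sound hll hLlo60 (y := Real.log x) hLloR
        have hγ := gamma_bounds.2
        have hsum' : ((seriesLo Llo : ℤ) : ℝ) ≤ (∑ k ∈ range NT, logIntegralSeriesTerm (x : ℝ) k) * 2 ^ 80 :=
          hser.trans (mul_le_mul_of_nonneg_right hsum (by positivity))
        generalize seriesLo Llo = T at hsum' ⊢
        generalize ∑ k ∈ range NT, logIntegralSeriesTerm (x : ℝ) k = Ssum at hli hsum'
        push_cast
        nlinarith
      · -- impossible in practice; but then `loglogLo` used `m = 0` and `logIv 0 = none`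
        exfalso
        unfold loglogLo at hll
        have hm : Llo.toNat / 2 ^ 60 = 0 := by
          rw [Nat.div_eq_zero_iff]
          right
          by_contra hc
          rw [not_lt] at hc
          have : (2 : ℤ) ^ 60 ≤ (Llo.toNat : ℤ) := by exact_mod_cast hc
          have h2 : (Llo.toNat : ℤ) ≤ max Llo 0 := by simp
          omega
        rw [hm] at hll
        simp [logIv] at hll
    · simp at h
  · simp at h

/-! ### Primality by the table -/

/-- Completeness of `firstFactor` on a sorted list: a member `p` with `p² ≤ n`, `p ∣ n` is reached. [folklore] -/
theorem firstFactor_isSome_of_mem : ∀ (l : List ℕ), l.Pairwise (· < ·) → ∀ {p n : ℕ}, p ∈ l → p * p ≤ n → p ∣ n →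
    (firstFactor l n).isSome = true
  | [], _, p, n, hp, _, _ => by simp at hp
  | q :: t, hl, p, n, hp, hpn, hdvd => by
      rw [List.pairwise_cons] at hl
      simp only [firstFactor]
      rcases List.mem_cons.1 hp with rfl | hpt
      · rw [if_neg (not_lt.2 hpn)]
        simp [Nat.mod_eq_zero_of_dvd hdvd]
      · have hqp : q < p := hl.1 p hpt
        have hqn : ¬ n < q * q := not_lt.2 (le_trans (Nat.mul_le_mul hqp.le hqp.le) hpn)
        rw [if_neg hqn]
        by_cases hq : n % q = 0
        · simp [hq]
        · rw [if_neg hq]; exact firstFactor_isSome_of_mem t hl.2 hpt hpn hdvd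

/-- **`isPrimeF` decides primality below `10007²`** (in particular for `n ≤ 10⁸`). [folklore] -/
theorem isPrimeF_iff {n : ℕ} (hn : n ≤ 10 ^ 8) : isPrimeF n = true ↔ n.Prime := by
  unfold isPrimeF
  rw [Bool.and_eq_true, decide_eq_true_eq]
  constructor
  · rintro ⟨h2, hnone⟩
    rw [Nat.prime_def_minFac]
    refine ⟨h2, ?_⟩
    by_contra hne
    have hmin := Nat.minFac_prime (show n ≠ 1 by omega)
    have hle : n.minFac * n.minFac ≤ n := by
      have := Nat.minFac_sq_le_self (n := n) (by omega) (fun hp ↦ hne hp.minFac_eq)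
      simpa [sq] using this
    have hsmall : n.minFac ≤ 10007 := by
      by_contra hc
      rw [not_le] at hc
      have : 10008 * 10008 ≤ n := le_trans (Nat.mul_le_mul hc hc) hle
      omega
    have hmem : n.minFac ∈ primeTable :=
      tableOK_complete primeTable_ok primeTable_ne_nil _ hmin (by rw [primeTable_getLast]; exact hsmall)
    have hsome := firstFactor_isSome_of_mem primeTable (pairwise_of_incr _ primeTable_incr) hmem hle
      (Nat.minFac_dvd n)
    rw [Option.isNone_iff_eq_none] at hnone
    rw [hnone] at hsome
    simp at hsome
  · intro hp
    refine ⟨hp.two_le, ?_⟩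
    rw [Option.isNone_iff_eq_none]
    by_contra hc
    obtain ⟨q, hq⟩ := Option.ne_none_iff_exists'.1 hc
    obtain ⟨hmem, hdvd, hsq⟩ := firstFactor_spec _ _ _ hq
    have hqp : q.Prime := primeTable_prime q hmem
    have hqn : q = n := ((Nat.dvd_prime hp).1 hdvd).resolve_left hqp.one_lt.ne'
    subst hqn
    have : 2 ≤ q := hqp.two_le
    nlinarith

/-- `countFrom n len cnt = cnt + #{m ∈ [n, n+len) : isPrimeF m}`. [folklore] -/
theorem countFrom_eq : ∀ (len n cnt : ℕ),
    countFrom n len cnt = cnt + ((List.range' n len).filter (fun m ↦ isPrimeF m)).length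
  | 0, n, cnt => by simp [countFrom]
  | len + 1, n, cnt => by
      rw [countFrom, countFrom_eq len (n + 1), List.range'_succ, List.filter_cons]
      by_cases h : isPrimeF n = true
      · simp [h]; omega
      · simp [h]

/-- **`countFrom` continues `π`**: if `cnt = π(n − 1)`, `1 ≤ n` and `n + len ≤ 10⁸ + 1` then
`countFrom n len cnt = π(n + len − 1)`. [folklore] -/
theorem countFrom_primeCounting {n len cnt : ℕ} (hn : 1 ≤ n) (hN : n + len ≤ 10 ^ 8 + 1)
    (hc : cnt = Nat.primeCounting (n - 1)) : countFrom n len cnt = Nat.primeCounting (n + len - 1) := by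
  induction len generalizing n cnt with
  | zero => simp [countFrom, hc]
  | succ len ih =>
    rw [countFrom]
    have hstep : (if isPrimeF n = true then cnt + 1 else cnt) = Nat.primeCounting n := by
      have e : n - 1 + 1 = n := by omega
      have hiff := isPrimeF_iff (n := n) (by omega)
      rw [hc, Nat.primeCounting, Nat.primeCounting, Nat.primeCounting', e, Nat.count_succ]
      by_cases hp : n.Prime
      · rw [if_pos (hiff.2 hp), if_pos hp]
      · have : ¬ isPrimeF n = true := fun h ↦ hp (hiff.1 h)
        rw [if_neg this, if_neg hp]
        rfl
    rw [ih (n := n + 1) (by omega) (by omega) (by simpa using hstep)]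
    congr 1; omega

/-! ### One cell -/

/-- `cellData a = some (Llo, rhs)` gives `0 < Llo ≤ 2⁸⁰ log a` and `rhs = isqrt(a)·Llo·10⁶ ≤ 2⁸⁰·KK·√a log a/(8π)`.
[folklore] -/
theorem cellData_sound {a : ℕ} {Llo rhs : ℤ} (h : cellData a = some (Llo, rhs)) (ha : 1 ≤ a) :
    0 < Llo ∧ (rhs : ℝ) ≤ Real.sqrt a * Real.log a / (8 * Real.pi) * KK * 2 ^ 80 := by
  unfold cellData at h
  split at h
  · rename_i lo hi hlog
    split_ifs at h with hpos
    simp only [Option.some.injEq, Prod.mk.injEq] at h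
    obtain ⟨rfl, rfl⟩ := h
    refine ⟨hpos, ?_⟩
    have hl := (logIv_sound hlog).1
    have hsq : (Nat.sqrt a : ℝ) ≤ Real.sqrt a := by
      rw [Real.le_sqrt (by positivity) (by positivity)]
      exact_mod_cast Nat.sqrt_le' a
    have hπ := Real.pi_lt_d6
    have hπ0 := Real.pi_pos
    have hK : 8 * Real.pi * 1000000 ≤ (KK : ℝ) := by unfold KK; push_cast; nlinarith
    have hlo0 : (0 : ℝ) ≤ lo := by exact_mod_cast hpos.le
    have hloga : (lo : ℝ) ≤ Real.log a * 2 ^ 80 := by rwa [div_le_iff₀ (by positivity)] at hl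
    have hlog0 : 0 ≤ Real.log a := Real.log_nonneg (by exact_mod_cast ha)
    push_cast
    have h1 : (Nat.sqrt a : ℝ) * lo ≤ Real.sqrt a * (Real.log a * 2 ^ 80) :=
      mul_le_mul hsq hloga hlo0 (Real.sqrt_nonneg _)
    calc (Nat.sqrt a : ℝ) * lo * 1000000 ≤ Real.sqrt a * (Real.log a * 2 ^ 80) * 1000000 := by nlinarith
      _ = Real.sqrt a * Real.log a / (8 * Real.pi) * (8 * Real.pi * 1000000) * 2 ^ 80 := by field_simp
      _ ≤ Real.sqrt a * Real.log a / (8 * Real.pi) * KK * 2 ^ 80 := by gcongr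
  · simp at h

/-- **Soundness of one cell check.** [folklore] -/
theorem cell_sound {a b : ℕ} {Llo rhs llA lhB : ℤ} (ha : 3 ≤ a) (hab : a < b)
    (hcd : cellData a = some (Llo, rhs)) (hll : liLo a = some llA) (hlh : liHi b = some lhB)
    (hL : ((Nat.primeCounting (b - 1) : ℤ) * SC - llA) * KK < rhs)
    (hU : (lhB - (Nat.primeCounting a : ℤ) * SC) * KK < rhs) :
    ∀ x : ℝ, (a : ℝ) ≤ x → x < b →
      |(Nat.primeCounting ⌊x⌋₊ : ℝ) - logIntegral x| < Real.sqrt x * Real.log x / (8 * Real.pi) := by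
  intro x hax hxb
  obtain ⟨hLlo0, hrhs⟩ := cellData_sound hcd (by omega)
  have ha1 : (1 : ℝ) < a := by exact_mod_cast (lt_of_lt_of_le (by norm_num) ha)
  have hx1 : 1 < x := by linarith
  have hx0 : 0 ≤ x := by linarith
  have hb1 : 1 < b := by omega
  -- the floor
  have hfl1 : a ≤ ⌊x⌋₊ := Nat.le_floor hax
  have hfl2 : ⌊x⌋₊ ≤ b - 1 := by have := (Nat.floor_lt hx0).2 hxb; omega
  have hπ1 : (Nat.primeCounting a : ℝ) ≤ Nat.primeCounting ⌊x⌋₊ := by exact_mod_cast Nat.monotone_primeCounting hfl1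
  have hπ2 : (Nat.primeCounting ⌊x⌋₊ : ℝ) ≤ Nat.primeCounting (b - 1) := by
    exact_mod_cast Nat.monotone_primeCounting hfl2
  -- li
  have hmono : StrictMonoOn logIntegral (Set.Ioi 1) := strictMonoOn_logIntegral_holds
  have hli1 : logIntegral a ≤ logIntegral x := hmono.monotoneOn ha1 hx1 hax
  have hli2 : logIntegral x ≤ logIntegral b :=
    hmono.monotoneOn hx1 (show (1 : ℝ) < (b : ℝ) by exact_mod_cast hb1) hxb.le
  have hlo := liLo_sound hll ha
  have hhi := liHi_sound hlh hb1
  -- the bound grows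
  have hbd : Real.sqrt a * Real.log a / (8 * Real.pi) ≤ Real.sqrt x * Real.log x / (8 * Real.pi) := by
    have hπ0 := Real.pi_pos
    refine div_le_div_of_nonneg_right ?_ (by positivity)
    exact mul_le_mul (Real.sqrt_le_sqrt hax) (Real.log_le_log (by positivity) hax)
      (Real.log_nonneg ha1.le) (Real.sqrt_nonneg _)
  -- integer checks to reals
  have hKK : (0 : ℝ) < KK := by unfold KK; norm_num
  have hUr : ((lhB : ℝ) - (Nat.primeCounting a : ℝ) * 2 ^ 80) * KK < rhs := by
    have : (((lhB - (Nat.primeCounting a : ℤ) * SC) * KK : ℤ) : ℝ) < (rhs : ℝ) := by exact_mod_cast hU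
    rw [← SC_eq]; push_cast at this ⊢; exact this
  have hLr : ((Nat.primeCounting (b - 1) : ℝ) * 2 ^ 80 - llA) * KK < rhs := by
    have : ((((Nat.primeCounting (b - 1) : ℤ) * SC - llA) * KK : ℤ) : ℝ) < (rhs : ℝ) := by exact_mod_cast hL
    rw [← SC_eq]; push_cast at this ⊢; exact this
  set B := Real.sqrt a * Real.log a / (8 * Real.pi) with hB
  have hup : logIntegral x - Nat.primeCounting ⌊x⌋₊ < B := by
    have h1 : ((lhB : ℝ) - (Nat.primeCounting a : ℝ) * 2 ^ 80) < B * 2 ^ 80 := by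
      by_contra hc
      rw [not_lt] at hc
      have := mul_le_mul_of_nonneg_right hc hKK.le
      nlinarith
    nlinarith
  have hdown : (Nat.primeCounting ⌊x⌋₊ : ℝ) - logIntegral x < B := by
    have h1 : ((Nat.primeCounting (b - 1) : ℝ) * 2 ^ 80 - llA) < B * 2 ^ 80 := by
      by_contra hc
      rw [not_lt] at hc
      have := mul_le_mul_of_nonneg_right hc hKK.le
      nlinarith
    nlinarith
  rw [abs_lt]
  constructor <;> linarith

/-! ### The loop -/

/-- `countFrom a 1 cnt` is the one-step update. [folklore] -/
theorem countFrom_one (a cnt : ℕ) : countFrom a 1 cnt = (if isPrimeF a then cnt + 1 else cnt) := by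
  simp [countFrom]

/-- **Soundness of the cell loop**: a successful run from `a` with the correct count `π(a − 1)` returns
`π(stop − 1)` and proves (6.18) on `[a, stop)`. [folklore] -/
theorem runCells_sound : ∀ (fuel a stop cnt : ℕ) (lhA : ℤ) (c' : ℕ),
    runCells fuel a stop cnt lhA = some c' → 3 ≤ a → a ≤ stop → stop ≤ 10 ^ 8 →
    cnt = Nat.primeCounting (a - 1) →
    c' = Nat.primeCounting (stop - 1) ∧
      ∀ x : ℝ, (a : ℝ) ≤ x → x < stop →
        |(Nat.primeCounting ⌊x⌋₊ : ℝ) - logIntegral x| < Real.sqrt x * Real.log x / (8 * Real.pi)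
  | 0, a, stop, cnt, lhA, c', h, ha, has, hs, hc => by
      simp only [runCells] at h
      split_ifs at h with he
      simp only [Option.some.injEq] at h
      subst he; subst h
      exact ⟨hc, fun x h1 h2 ↦ absurd (lt_of_le_of_lt h1 h2) (lt_irrefl _)⟩
  | fuel + 1, a, stop, cnt, lhA, c', h, ha, has, hs, hc => by
      rw [runCells] at h
      by_cases hsa : stop ≤ a
      · rw [if_pos hsa] at h
        have he : a = stop := le_antisymm has hsa
        rw [if_pos he] at h
        simp only [Option.some.injEq] at h
        subst he; subst h
        exact ⟨hc, fun x h1 h2 ↦ absurd (lt_of_le_of_lt h1 h2) (lt_irrefl _)⟩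
      rw [if_neg hsa] at h
      rw [not_le] at hsa
      -- `π(a)`
      have hpia : (if isPrimeF a = true then cnt + 1 else cnt) = Nat.primeCounting a := by
        rw [← countFrom_one, countFrom_primeCounting (by omega) (by omega) hc]
        congr 1
      generalize hP : (if isPrimeF a = true then cnt + 1 else cnt) = pia at h hpia
      split at h
      · rename_i Llo rhs llA hcd hll
        dsimp only at h
        -- name the cell end
        generalize hb : min stop (a + max 1 ((rhs / KK - (lhA - (pia : ℤ) * SC)) * Llo * 4 / 5 / (SC * SC)).toNat) = b at h
        have hab : a < b := by rw [← hb]; exact lt_min hsa (by omega)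
        have hbs : b ≤ stop := by rw [← hb]; exact min_le_left _ _
        have hpib : countFrom (a + 1) (b - (a + 1)) pia = Nat.primeCounting (b - 1) := by
          rw [countFrom_primeCounting (by omega) (by omega) (by simpa using hpia.symm ▸ rfl)]
          congr 1; omega
        generalize hpb : countFrom (a + 1) (b - (a + 1)) pia = pib at h hpib
        split at h
        · rename_i lhB hlh
          split_ifs at h with hchk
          obtain ⟨hL, hU⟩ := hchk
          subst hpia; subst hpib
          have ih := runCells_sound fuel b stop _ lhB c' h (by omega) hbs hs rfl
          refine ⟨ih.1, fun x hx1 hx2 ↦ ?_⟩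
          by_cases hxb : x < b
          · exact cell_sound ha hab hcd hll hlh hL hU x hx1 hxb
          · exact ih.2 x (not_lt.1 hxb) hx2
        · simp at h
      · simp at h

/-! ### Block interface -/

/-- **The block invariant** at a boundary `a` with count `c`: `c = π(a − 1)` and (6.18) holds on `[2659, a)`.
[folklore] -/
def SegOK (a c : ℕ) : Prop :=
  c = Nat.primeCounting (a - 1) ∧
    ∀ x : ℝ, 2659 ≤ x → x < a →
      |(Nat.primeCounting ⌊x⌋₊ : ℝ) - logIntegral x| < Real.sqrt x * Real.log x / (8 * Real.pi)

/-- The start: `π(2658) = 384`. [folklore] -/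
theorem segOK_start : SegOK 2659 384 :=
  ⟨by rw [show 2659 - 1 = 2658 from rfl, primeCounting_2658],
    fun x h1 h2 ↦ absurd (lt_of_le_of_lt h1 (by exact_mod_cast h2)) (lt_irrefl _)⟩

/-- **One block**: a passing `checkSeg a stop cIn cOut` carries the invariant from `a` to `stop`. [folklore] -/
theorem segOK_step {a stop cIn cOut : ℕ} (h : checkSeg a stop cIn cOut = true) (ha : 2659 ≤ a)
    (has : a ≤ stop) (hs : stop ≤ 10 ^ 8) (hseg : SegOK a cIn) : SegOK stop cOut := by
  unfold checkSeg at h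
  split at h
  · rename_i lhA _
    have hrun : runCells (stop - a + 1) a stop cIn lhA = some cOut := by simpa using h
    have hsound := runCells_sound _ _ _ _ _ _ hrun (by omega) has hs hseg.1
    refine ⟨hsound.1, fun x hx1 hx2 ↦ ?_⟩
    by_cases hxa : x < a
    · exact hseg.2 x hx1 hxa
    · exact hsound.2 x (not_lt.1 hxa) hx2
  · simp at h

end Soundness

end SchoenfeldSieve

end Literature.NumberTheory.LFunctions
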